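import Mathlib.NumberTheory.Padics.ProperSpace
import Mathlib.Topology.Algebra.Polynomial
import Literature.NumberTheory.EllipticCurves.BSDRootNumber
import HarnessLib

/-!
# Local constancy of local root numbers in `p`-adic families (Helfgott 2004, §4)

Topic `NumberTheory/EllipticCurves`; namespace `Literature.NumberTheory.EllipticCurves`. Companion
of `BSDRootNumber` (the named fact `exists_local_tables_two_three`: local tables
`w_v : WeierstrassCurve ℚ_v → ℤ` of `±1`-valued local root numbers at all finite places of `ℚ`,
including `2` and `3`, computing the global root number `w(E) = −∏_v w_v(E)` of every `E/ℚ`).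

H. A. Helfgott, *On the behaviour of root numbers in families of elliptic curves*,
arXiv:math/0408141 (2004), §4 "Local root numbers" (held copy `paper:arxiv-math_0408141`, PDF
chunks 10–11):

* **Proposition 4.2.** "Let `K` be a local field. Let `a₁, …, a₆ ∈ 𝒪_K` be the coefficients of a
  Weierstrass model for an elliptic curve `E` with potential good reduction. Then there is an
  `ε > 0` such that any `𝐚₁, …, 𝐚₆ ∈ 𝒪_K` with `|𝐚_j − a_j| < ε` are the coefficients of a
  Weierstrass model for an elliptic curve `𝐄` with `W(𝐄) = W(E)`."
* **Proposition 4.3.** "Let `K` be a local field of characteristic `≠ 2`. Let `a₁, …, a₆ ∈ K`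
  induce a tuple `(c₄, c₆, Δ) ∈ K³` with `c₄ ≠ 0`, `Δ = 0`. Then there is a constant `w ∈ {−1, 1}`
  and an `ε > 0` such that any `𝐚₁, …, 𝐚₆ ∈ K` with `|𝐚_j − a_j| < ε` and `𝚫 ≠ 0` give a
  Weierstrass model for an elliptic curve `𝐄` with `W(𝐄) = w`." — and the last paragraph of its
  proof gives the same local constancy around an *elliptic* curve with potentially multiplicative
  reduction (this is how Lemma 4.4 is proved: "If `𝓔(t₀)` has potentially good reduction, apply
  Prop. 4.2. If `𝓔(t₀)` has potentially multiplicative reduction, proceed as in the last paragraph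
  of the proof of Prop. 4.3").

Since every elliptic curve over a local field has potentially good or potentially multiplicative
reduction, together: **the local root number `W(E/K)` is a locally constant function of the
integral coefficients `(a₁, …, a₆) ∈ 𝒪_K⁵` of the elliptic curve `E`.** Here `W(E/K)` is the local
root number of Deligne–Langlands (`ε`-factor of the Weil–Deligne representation of `E`; Dokchitser,
*Notes on the parity conjecture*, Def. 35) — at residue characteristic `2, 3` included ("we must
include in our treatment local fields `K` whose residue fields have characteristic `2` or `3`",
Helfgott p. 10).

Rendering. The tree has no definition of `W(E/ℚ_v)` at the additive places above `2, 3`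
(`WeierstrassCurve.localRootNumber` carries the documented junk value `0` there), and vendors the
local root numbers at ALL places in the existential form `exists_local_tables_two_three` of
`BSDRootNumber` (tables `w_v` that are `±1`-valued, invariant under changes of variables, equal to
Rohrlich's `localRootNumber` in residue characteristic `> 3`, and compute `WeierstrassCurve.rootNumber`
by the product formula). Local constancy is a property of the *true* local root numbers, not of an
arbitrary table with those four properties (which do not pin down `w₂`, `w₃` separately), so it is
vendored as a **fifth clause of the same existential**:

* `Helfgott2004_exists_local_tables_locallyConstant` — there are local tables `w_v` with the four
  properties of `exists_local_tables_two_three` AND: for every finite place `v` of `ℚ` and every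
  elliptic `W'` over `ℚ_v` with `v`-integral coefficients there is `n ∈ ℕ` such that every
  elliptic `W''` with `v`-integral coefficients `𝐚_j`, `v(𝐚_j − a_j) < exp (−n)` (`j = 1, 2, 3, 4, 6`),
  has `w_v(W'') = w_v(W')` (Helfgott, Prop. 4.2 and proof of Prop. 4.3 / Lemma 4.4, for `K = ℚ_v`).
  The witness is `w_v(W') = W(E'/ℚ_v)` for elliptic `W'` (and `1` on singular `W'`), exactly as for
  `exists_local_tables_two_three`, which it implies (`exists_local_tables_two_three_of_locallyConstant`).
  "`|𝐚_j − a_j| < ε`" is rendered `Valued.v (𝐚_j − a_j) < exp (−n)` for a natural number `n`, in the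
  value group `ℤₘ₀` of `ℚ_v = v.adicCompletion ℚ` (the valuation takes the values `exp (m)`,
  `m ∈ ℤ`, and `0`, so these sets are a basis of neighbourhoods of `0` — `v(x) < exp (−n)` says
  `x ∈ p^{n+1} 𝒪_v`); "`∈ 𝒪_K`" is membership in `v.adicCompletionIntegers ℚ`; the ellipticity of
  `W''`, a conclusion in Prop. 4.2, is taken as a hypothesis (weaker).
* `exists_forall_sub_mem_pow_imp_eq_of_locallyConstant` (**proved**, the compactness consequence
  used by `p`-adic families): if `w : WeierstrassCurve ℚ_v → ℤ` is locally constant in the sense of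
  clause (5) and `t ↦ E_t` is a polynomial family (`polyCurve P₁ P₂ P₃ P₄ P₆ t`, coefficients
  `Pⱼ(t)`, `Pⱼ ∈ ℤ[X]`) all of whose fibres over `𝒪_v` are non-singular, then `t ↦ w(E_t ×_ℚ ℚ_v)`
  on `ℤ` factors through `ℤ / v^K` for some `K` (`𝒪_v ≅ ℤ_p` is compact, Mathlib
  `PadicInt.compactSpace` and `Rat.HeightOneSpectrum.adicCompletionIntegers.padicIntEquiv`;
  `v(Pⱼ(t) − Pⱼ(t')) ≤ v(t − t')`). `Δ_ne_zero_of_forall_not_mem_pow` supplies the hypothesis from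
  the arithmetic condition "`v(Δ(E_t))` is bounded on `t ∈ ℤ`" (density of `ℤ` in `𝒪_v`).

## References

* H. A. Helfgott, *On the behaviour of root numbers in families of elliptic curves*,
  arXiv:math/0408141 (2004), §4: Prop. 4.2, Prop. 4.3 and its proof, Lemma 4.4.
  [Helfgott2004RootNumberFamilies]
* T. Dokchitser, *Notes on the parity conjecture* (2013), Def. 35, Def. 39–40.
  [Dokchitser2013ParityNotes]
* D. Rohrlich, *Variation of the root number in families of elliptic curves*, Compositio Math. 87
  (1993), Prop. 2. [Rohrlich1993Compositio]
-/

noncomputable section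

open scoped Classical

open IsDedekindDomain WeierstrassCurve

namespace Literature.NumberTheory.EllipticCurves

/-- **Local root numbers of elliptic curves over `ℚ_v` are locally constant in the coefficients**
(Helfgott 2004, Prop. 4.2 — potentially good reduction — and the last paragraph of the proof of
Prop. 4.3 — potentially multiplicative reduction —, as combined in the proof of Lemma 4.4), vendored
as a strengthening of `exists_local_tables_two_three` (module docstring): there are local tables
`w_v : WeierstrassCurve ℚ_v → ℤ`, one for each finite place `v` of `ℚ`, which (1) are `±1`-valued,
(2) are invariant under every change of variables over `ℚ_v`, (3) agree with Rohrlich's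
`localRootNumber` on elliptic curves when the residue characteristic is `> 3`, (4) compute the global
root number of every elliptic `E/ℚ`, `w(E) = −∏_v w_v(E ×_ℚ ℚ_v)` — clauses (1)–(4) verbatim those of
`exists_local_tables_two_three` — and (5) **are locally constant**: for every `v` and every elliptic
`W'` over `ℚ_v` with coefficients `a_j ∈ 𝒪_v` "there is an `ε > 0` such that any `𝐚₁, …, 𝐚₆ ∈ 𝒪_v`
with `|𝐚_j − a_j| < ε` are the coefficients of … an elliptic curve `𝐄` with `W(𝐄) = W(E)`" — here:
there is `n ∈ ℕ` such that every elliptic `W''` with coefficients in `𝒪_v` and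
`v(𝐚_j − a_j) < exp (−n)` for `j = 1, 2, 3, 4, 6` has `w_v(W'') = w_v(W')`. Named fact; the witness is the
Deligne–Langlands local root number `W(E/ℚ_v)` (Dokchitser 2013, Def. 35), for which (1)–(4) are the
sources of `exists_local_tables_two_three` and (5) is Helfgott's §4.

Status (D-0026/D-0027 review-split, 2026-08-15; Lean statement unchanged). Reviewed with the
source open (held copy `paper:arxiv-math_0408141`, PDF pp. 10–11): clause (5) is Helfgott's
Prop. 4.2 (potentially good reduction) and the last paragraph of the proof of Prop. 4.3
(potentially multiplicative reduction), combined as in the proof of Lemma 4.4, at `K = ℚ_v`; the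
statement is faithful and stays as filed for its consumer (route item `stmt-Parity-7170`:
periodicity of `t ↦ w₂(𝓔_t)` through `exists_forall_sub_mem_pow_imp_eq_of_locallyConstant`
below). It is a *terminal* named fact of the present tree, not a decomposition child: it implies
**bsd.S36** `exists_local_tables_two_three` (`exists_local_tables_two_three_of_locallyConstant`),
itself terminal — clause (4) is the product formula for the *analytic* sign
`WeierstrassCurve.rootNumber`, every known proof of which passes through the Modularity Theorem
(`Literature.NumberTheory.EllipticCurves.ModularForms.exists_isNewformOf`, an undischarged named
fact; Breuil–Conrad–Diamond–Taylor 2001, Thm. A) and local–global compatibility at the additive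
places above `2, 3` (Kellock–Dokchitser 2023, Rem. 2.2). What the tree proves (sibling `…Proofs`
files, theorems only): (i) clause (5) at every `v ∤ 6` for Rohrlich's table —
`localRootNumber_adicCompletion_locallyConstant`, Helfgott's own argument in residue
characteristic `≥ 5` (one minimising change of variables for all nearby equations, constancy of
the reduction type and of `v(Δ_min)`), whence
`Helfgott2004_exists_local_tables_locallyConstant_iff_two_three`: beyond bsd.S36 only local
constancy above `2, 3` is asked (file `RootNumberLocalConstancyProofs`); (ii) the whole fact from
{`exists_isNewformOf`, Kellock–Dokchitser Rem. 2.2 above `p ≥ 5`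
(`WeierstrassCurve.atkinLehnerEigenvalueAt_eq_localRootNumberAt`), `p`-adic local constancy of the
Atkin–Lehner sign `λ(Q_p)(f_E)` around the `p`-integral elliptic equations over `ℚ_p` whose
minimal model has *additive* reduction, `p = 2, 3`} —
`Helfgott2004_exists_local_tables_locallyConstant_of_residual_additive` (files
`RootNumberLocalConstancyResidualProofs`, `RootNumberLocalConstancySemistableProofs`; the
semistable equations above `2, 3` are settled unconditionally there). The last input is
Helfgott's Prop. 4.2 at `K = ℚ₂, ℚ₃` ("`ι_n` induces an isomorphism of Tate modules
`T_ℓ(E) → T_ℓ(𝐄)` as `Gal(K̄/K)`-modules. … the root number `W(E)` … is determined by the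
representation of the Weil group `𝒲(K) ⊂ Gal(K̄/K)` on `T_ℓ(E)` …. Hence `W(E) = W(𝐄)`", PDF
p. 10) read through `W(E/ℚ_p) = λ(Q_p)(f_E)`; the tree has neither the Deligne–Langlands local
constant of an elliptic curve over `ℚ₂, ℚ₃` nor that compatibility, so no inline proof exists
today, and no honest restatement is provable instead: restricted to `v ∤ 6` the statement *is* the
theorem `localRootNumber_adicCompletion_locallyConstant` (a weakening, useless to the consumer,
which needs `v = 2`), while the tables at `2, 3` cannot be pinned without clause (4) for want of a
definition of `W(E/ℚ_v)` there. The discharge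
`Helfgott2004_exists_local_tables_locallyConstant_holds` therefore waits on `exists_isNewformOf`
(and, beyond it, on local Langlands for `GL₂(ℚ₂)`, `GL₂(ℚ₃)`), exactly as
`exists_local_tables_two_three`.
[cite: Helfgott2004RootNumberFamilies, Prop. 4.2, Prop. 4.3 (proof) and Lemma 4.4]
[cite: Dokchitser2013ParityNotes, Def. 35, Def. 39–40] [cite: Rohrlich1993Compositio, Prop. 2]
[cite: BCDTJAMS2001, Thm. A] [cite: KellockDokchitser2023, Def. 2.1, Rem. 2.2, Thm. 2.3] -/
def Helfgott2004_exists_local_tables_locallyConstant : Prop :=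
  ∃ w : (v : HeightOneSpectrum ℤ) → WeierstrassCurve (v.adicCompletion ℚ) → ℤ,
      (∀ v W', w v W' = 1 ∨ w v W' = -1) ∧
      (∀ v W' (C : VariableChange (v.adicCompletion ℚ)), w v (C • W') = w v W') ∧
      (∀ v (W' : WeierstrassCurve (v.adicCompletion ℚ)), W'.IsElliptic →
        3 < ringChar (ℤ ⧸ v.asIdeal) → w v W' = W'.localRootNumber (v.adicCompletionIntegers ℚ)) ∧
      (∀ W : WeierstrassCurve ℚ, W.IsElliptic →
        W.rootNumber = -∏ᶠ v : HeightOneSpectrum ℤ, w v (W.baseChange (v.adicCompletion ℚ))) ∧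
      ∀ (v : HeightOneSpectrum ℤ) (W' : WeierstrassCurve (v.adicCompletion ℚ)), W'.IsElliptic →
        W'.a₁ ∈ v.adicCompletionIntegers ℚ → W'.a₂ ∈ v.adicCompletionIntegers ℚ →
        W'.a₃ ∈ v.adicCompletionIntegers ℚ → W'.a₄ ∈ v.adicCompletionIntegers ℚ →
        W'.a₆ ∈ v.adicCompletionIntegers ℚ →
        ∃ n : ℕ,
          ∀ W'' : WeierstrassCurve (v.adicCompletion ℚ), W''.IsElliptic →
            W''.a₁ ∈ v.adicCompletionIntegers ℚ → W''.a₂ ∈ v.adicCompletionIntegers ℚ →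
            W''.a₃ ∈ v.adicCompletionIntegers ℚ → W''.a₄ ∈ v.adicCompletionIntegers ℚ →
            W''.a₆ ∈ v.adicCompletionIntegers ℚ →
            Valued.v (W''.a₁ - W'.a₁) < WithZero.exp (-(n : ℤ)) →
            Valued.v (W''.a₂ - W'.a₂) < WithZero.exp (-(n : ℤ)) →
            Valued.v (W''.a₃ - W'.a₃) < WithZero.exp (-(n : ℤ)) →
            Valued.v (W''.a₄ - W'.a₄) < WithZero.exp (-(n : ℤ)) →
            Valued.v (W''.a₆ - W'.a₆) < WithZero.exp (-(n : ℤ)) → w v W'' = w v W'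

/-- The locally constant local tables are in particular local tables: Helfgott's strengthening
implies `exists_local_tables_two_three` (drop clause (5)). [folklore] -/
theorem exists_local_tables_two_three_of_locallyConstant
    (h : Helfgott2004_exists_local_tables_locallyConstant) : exists_local_tables_two_three := by
  obtain ⟨w, h1, h2, h3, h4, -⟩ := h
  exact ⟨w, h1, h2, h3, h4⟩

/-! ### Polynomial families: the compactness consequence -/

section Families

open Polynomial IsDedekindDomain.HeightOneSpectrum

/-- The **polynomial family** of Weierstrass curves `t ↦ E_t` with coefficients
`a_j(t) = P_j(t)`, `P_j ∈ ℤ[X]` (`j = 1, 2, 3, 4, 6`), over any commutative ring `A` (e.g. `ℤ`, `ℚ`,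
`ℚ_v`): `E_t : a₁ = P₁(t), …, a₆ = P₆(t)` (the `P_j` are mapped along `Int.castRingHom A`, so that no
`ℤ`-algebra structure on `A` is involved). (Helfgott 2004, §4: the fibres `𝓔(t)` of an elliptic
curve over `K(T)`.) [cite: Helfgott2004RootNumberFamilies, §4] -/
def polyCurve (P₁ P₂ P₃ P₄ P₆ : ℤ[X]) {A : Type*} [CommRing A] (t : A) : WeierstrassCurve A :=
  ⟨(P₁.map (Int.castRingHom A)).eval t, (P₂.map (Int.castRingHom A)).eval t,
    (P₃.map (Int.castRingHom A)).eval t, (P₄.map (Int.castRingHom A)).eval t,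
    (P₆.map (Int.castRingHom A)).eval t⟩

/-- `f (P(t)) = P(f t)` for an integer polynomial `P` and a ring homomorphism `f`. [folklore] -/
theorem ringHom_eval_map_int {A B : Type*} [CommRing A] [CommRing B] (f : A →+* B) (t : A)
    (P : ℤ[X]) : f ((P.map (Int.castRingHom A)).eval t) = (P.map (Int.castRingHom B)).eval (f t) := by
  rw [eval_map, eval_map, hom_eval₂]
  congr 1
  exact RingHom.ext_int _ _

variable (P₁ P₂ P₃ P₄ P₆ : ℤ[X])

/-- The family commutes with ring homomorphisms: `(E_t).map f = E_{f t}`. [folklore] -/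
theorem map_polyCurve {A B : Type*} [CommRing A] [CommRing B] (f : A →+* B) (t : A) :
    (polyCurve P₁ P₂ P₃ P₄ P₆ t).map f = polyCurve P₁ P₂ P₃ P₄ P₆ (f t) := by
  simp only [polyCurve, WeierstrassCurve.map, ringHom_eval_map_int]

/-- In particular `E_t ×_A B = E_t` for the base change along an algebra map. [folklore] -/
theorem baseChange_polyCurve {A : Type*} (B : Type*) [CommRing A] [CommRing B] [Algebra A B]
    (t : A) :
    (polyCurve P₁ P₂ P₃ P₄ P₆ t).baseChange B = polyCurve P₁ P₂ P₃ P₄ P₆ (algebraMap A B t) :=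
  map_polyCurve P₁ P₂ P₃ P₄ P₆ (algebraMap A B) t

/-- Every member is a specialisation of the generic member `E_X` over `ℤ[X]`. [folklore] -/
theorem polyCurve_X_map {A : Type*} [CommRing A] (t : A) :
    (polyCurve P₁ P₂ P₃ P₄ P₆ (X : ℤ[X])).map (eval₂RingHom (Int.castRingHom A) t) =
      polyCurve P₁ P₂ P₃ P₄ P₆ t := by
  have hC : Int.castRingHom ℤ[X] = C := RingHom.ext_int _ _
  have h : ∀ P : ℤ[X], (P.map (Int.castRingHom ℤ[X])).eval X = P := fun P => by
    rw [hC, eval_map, eval₂_C_X]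
  simp only [polyCurve, WeierstrassCurve.map, h, coe_eval₂RingHom, eval_map]

/-- The discriminant of the family is the discriminant polynomial of the generic member evaluated
at `t`: `Δ(E_t) = (Δ(E_X))(t)`. [folklore] -/
theorem polyCurve_Δ {A : Type*} [CommRing A] (t : A) :
    (polyCurve P₁ P₂ P₃ P₄ P₆ t).Δ =
      ((polyCurve P₁ P₂ P₃ P₄ P₆ (X : ℤ[X])).Δ.map (Int.castRingHom A)).eval t := by
  rw [← polyCurve_X_map, WeierstrassCurve.map_Δ, coe_eval₂RingHom, eval_map]

variable (v : HeightOneSpectrum ℤ)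

/-- `v(z) = v.intValuation z` for an integer `z ∈ ℤ ⊆ ℚ_v` (Mathlib `valuedAdicCompletion_eq_valuation'`
for the `Int.cast` spelling). [folklore] -/
theorem adicCompletion_valued_intCast (z : ℤ) :
    Valued.v ((z : v.adicCompletion ℚ)) = v.intValuation z := by
  have h : Valued.v (algebraMap ℚ (v.adicCompletion ℚ) (z : ℚ)) = v.valuation ℚ (z : ℚ) := by
    rw [algebraMap_adicCompletion, Function.comp_apply, Algebra.algebraMap_self, RingHom.id_apply,
      valuedAdicCompletion_eq_valuation']
  rw [← map_intCast (algebraMap ℚ (v.adicCompletion ℚ)) z, h,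
    show (z : ℚ) = algebraMap ℤ ℚ z from (eq_intCast (algebraMap ℤ ℚ) z).symm,
    valuation_of_algebraMap]

/-- Integers are `v`-adic integers. [folklore] -/
theorem intCast_mem_adicCompletionIntegers (z : ℤ) :
    (z : v.adicCompletion ℚ) ∈ v.adicCompletionIntegers ℚ := by
  rw [mem_adicCompletionIntegers, adicCompletion_valued_intCast]
  exact v.intValuation_le_one z

/-- There is a non-zero `z ∈ ℚ_v` with `v(z) ≤ exp(-1)` (any non-zero element of the prime `v`).
[folklore] -/
theorem adicCompletion_exists_valued_le_exp_neg_one :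
    ∃ z : v.adicCompletion ℚ, z ≠ 0 ∧ Valued.v z ≤ WithZero.exp (-1 : ℤ) := by
  obtain ⟨r, hr, hr0⟩ := Submodule.exists_mem_ne_zero_of_ne_bot v.ne_bot
  refine ⟨(r : v.adicCompletion ℚ), ?_, ?_⟩
  · intro h0
    have := congrArg Valued.v h0
    rw [adicCompletion_valued_intCast, Valuation.map_zero] at this
    exact v.intValuation_ne_zero r hr0 this
  · rw [adicCompletion_valued_intCast]
    have : r ∈ v.asIdeal ^ 1 := by rwa [pow_one]
    have h := (v.intValuation_le_pow_iff_mem r 1).2 this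
    simpa using h

/-- An integer polynomial takes `v`-integral values at `v`-integral points. [folklore] -/
theorem eval_map_int_mem_adicCompletionIntegers (P : ℤ[X]) {t : v.adicCompletion ℚ}
    (ht : t ∈ v.adicCompletionIntegers ℚ) :
    (P.map (Int.castRingHom (v.adicCompletion ℚ))).eval t ∈ v.adicCompletionIntegers ℚ := by
  have h := ringHom_eval_map_int (v.adicCompletionIntegers ℚ).subtype ⟨t, ht⟩ P
  change _ = (P.map (Int.castRingHom (v.adicCompletion ℚ))).eval t at h
  rw [← h]
  exact SetLike.coe_mem _

/-- **Ultrametric Lipschitz bound**: `v(P(t) − P(s)) ≤ v(t − s)` for an integer polynomial `P` and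
`v`-integral `t, s` (`P(t) − P(s) = (t − s) Q(t, s)` with `Q(t, s)` integral). [folklore] -/
theorem valued_eval_sub_eval_le (P : ℤ[X]) {t s : v.adicCompletion ℚ}
    (ht : t ∈ v.adicCompletionIntegers ℚ) (hs : s ∈ v.adicCompletionIntegers ℚ) :
    Valued.v ((P.map (Int.castRingHom (v.adicCompletion ℚ))).eval t -
        (P.map (Int.castRingHom (v.adicCompletion ℚ))).eval s) ≤ Valued.v (t - s) := by
  obtain ⟨c, hc⟩ := sub_dvd_eval_sub (⟨t, ht⟩ : v.adicCompletionIntegers ℚ) ⟨s, hs⟩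
    (P.map (Int.castRingHom (v.adicCompletionIntegers ℚ)))
  have hc' := congrArg ((v.adicCompletionIntegers ℚ).subtype) hc
  rw [map_sub, map_mul, map_sub, ringHom_eval_map_int, ringHom_eval_map_int] at hc'
  simp only [ValuationSubring.coe_subtype] at hc'
  rw [hc', Valuation.map_mul]
  have hcv : Valued.v (c : v.adicCompletion ℚ) ≤ 1 := (mem_adicCompletionIntegers ℤ ℚ v).1 c.2
  exact mul_le_of_le_one_right' hcv

/-- Open balls `{y : v(y) < v(z)}` of `ℚ_v` are open. [folklore] -/
theorem adicCompletion_isOpen_setOf_valued_lt (z : v.adicCompletion ℚ) :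
    IsOpen {y : v.adicCompletion ℚ | Valued.v y < Valued.v z} := by
  simpa only [Valuation.restrict_lt_iff] using
    Valued.isOpen_ball (v.adicCompletion ℚ) (Valued.v.restrict z)

/-- **`𝒪_v ⊆ ℚ_v` is compact**: it is the image of the closed unit ball `ℤ_p` of the proper space
`ℚ_p` under Mathlib's homeomorphism `ℚ_p ≃ ℚ_v` (`Rat.HeightOneSpectrum.adicCompletion.padicEquiv`,
`padicEquiv_bijOn`; `PadicInt.compactSpace`). [folklore] -/
theorem isCompact_adicCompletionIntegers_int :
    IsCompact (v.adicCompletionIntegers ℚ : Set (v.adicCompletion ℚ)) := by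
  haveI : Fact (Nat.Prime (Rat.HeightOneSpectrum.primesEquiv v : ℕ)) :=
    ⟨(Rat.HeightOneSpectrum.primesEquiv v).2⟩
  have hb := Rat.HeightOneSpectrum.adicCompletion.padicEquiv_bijOn v
  have hc : IsCompact ((PadicInt.subring (Rat.HeightOneSpectrum.primesEquiv v : ℕ) :
      Set ℚ_[Rat.HeightOneSpectrum.primesEquiv v])) := by
    have : (PadicInt.subring (Rat.HeightOneSpectrum.primesEquiv v : ℕ) :
        Set ℚ_[Rat.HeightOneSpectrum.primesEquiv v]) = Metric.closedBall 0 1 := by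
      ext x; simp [PadicInt.mem_subring_iff]
    rw [this]; exact isCompact_closedBall 0 1
  have himg : (Rat.HeightOneSpectrum.adicCompletion.padicEquiv v).symm ''
      (PadicInt.subring (Rat.HeightOneSpectrum.primesEquiv v : ℕ) :
        Set ℚ_[Rat.HeightOneSpectrum.primesEquiv v]) =
      (v.adicCompletionIntegers ℚ : Set (v.adicCompletion ℚ)) := by
    rw [← hb.image_eq, ← Set.image_comp]
    simp
  rw [← himg]
  exact hc.image (Rat.HeightOneSpectrum.adicCompletion.padicEquiv v).symm.continuous

/-- **`ℤ` is dense in `𝒪_v`**: every `v`-adic integer is within `v(z)` of an integer, for every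
`z ≠ 0` (transported from Mathlib's `PadicInt.denseRange_intCast` along `padicEquiv`). [folklore] -/
theorem exists_int_valued_sub_lt {x : v.adicCompletion ℚ} (hx : x ∈ v.adicCompletionIntegers ℚ)
    {z : v.adicCompletion ℚ} (hz : z ≠ 0) :
    ∃ r : ℤ, Valued.v ((r : v.adicCompletion ℚ) - x) < Valued.v z := by
  haveI : Fact (Nat.Prime (Rat.HeightOneSpectrum.primesEquiv v : ℕ)) :=
    ⟨(Rat.HeightOneSpectrum.primesEquiv v).2⟩
  let e := Rat.HeightOneSpectrum.adicCompletion.padicEquiv v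
  let U : Set (v.adicCompletion ℚ) := {y | Valued.v (y - x) < Valued.v z}
  have hUo : IsOpen U :=
    (adicCompletion_isOpen_setOf_valued_lt v z).preimage (continuous_id.sub continuous_const)
  have hxU : x ∈ U := by simp [U, (Valuation.pos_iff _).2 hz]
  have hex : e x ∈ PadicInt.subring (Rat.HeightOneSpectrum.primesEquiv v : ℕ) :=
    (Rat.HeightOneSpectrum.adicCompletion.padicEquiv_bijOn v).mapsTo hx
  let V : Set ℤ_[Rat.HeightOneSpectrum.primesEquiv v] :=
    {y | ((y : ℚ_[Rat.HeightOneSpectrum.primesEquiv v])) ∈ e '' U}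
  have hVo : IsOpen V := (e.toHomeomorph.isOpenMap U hUo).preimage continuous_subtype_val
  have hVne : V.Nonempty := ⟨⟨e x, hex⟩, ⟨x, hxU, rfl⟩⟩
  obtain ⟨r, hr⟩ := PadicInt.denseRange_intCast.exists_mem_open hVo hVne
  obtain ⟨y, hyU, hy⟩ := hr
  have hy' : y = (r : v.adicCompletion ℚ) := by
    have h1 : e.symm (e y) = y := e.symm_apply_apply y
    rw [← h1, hy, PadicInt.coe_intCast, map_intCast]
  exact ⟨r, hy' ▸ hyU⟩

/-- **Uniform local constancy on `𝒪_v` (compactness).** Let `w : WeierstrassCurve ℚ_v → ℤ` be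
locally constant in the sense of clause (5) of `Helfgott2004_exists_local_tables_locallyConstant` at
`v` (hypothesis `hloc`, e.g. `h.choose_spec.2.2.2.2 v` for `h : Helfgott2004_…`), and let
`t ↦ E_t = polyCurve P₁ P₂ P₃ P₄ P₆ t` be a polynomial family all of whose fibres at `t ∈ 𝒪_v` are
non-singular. Then there is `N` such that `w(E_t) = w(E_{t'})` whenever `t, t' ∈ 𝒪_v` and
`v(t − t') < exp(−N)`: each `t₀ ∈ 𝒪_v` has a ball on which `w(E_t) = w(E_{t₀})` (`hloc` at the
elliptic, integral `E_{t₀}`, and `v(P_j(t) − P_j(t₀)) ≤ v(t − t₀)`, `valued_eval_sub_eval_le`);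
finitely many balls cover the compact `𝒪_v` (`isCompact_adicCompletionIntegers_int`); take `N` the
largest modulus and use the ultrametric inequality. (The compactness step behind Helfgott 2004, §4,
"`t ↦ W(𝓔(t))` is locally constant almost everywhere", for families without degenerate fibres over
`𝒪_v`.) [cite: Helfgott2004RootNumberFamilies, §4 (Prop. 4.2, Lemma 4.4)] -/
theorem exists_forall_valued_sub_lt_imp_eq_of_locallyConstant
    {w : WeierstrassCurve (v.adicCompletion ℚ) → ℤ}
    (hloc : ∀ W' : WeierstrassCurve (v.adicCompletion ℚ), W'.IsElliptic →
        W'.a₁ ∈ v.adicCompletionIntegers ℚ → W'.a₂ ∈ v.adicCompletionIntegers ℚ →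
        W'.a₃ ∈ v.adicCompletionIntegers ℚ → W'.a₄ ∈ v.adicCompletionIntegers ℚ →
        W'.a₆ ∈ v.adicCompletionIntegers ℚ →
        ∃ n : ℕ, ∀ W'' : WeierstrassCurve (v.adicCompletion ℚ), W''.IsElliptic →
          W''.a₁ ∈ v.adicCompletionIntegers ℚ → W''.a₂ ∈ v.adicCompletionIntegers ℚ →
          W''.a₃ ∈ v.adicCompletionIntegers ℚ → W''.a₄ ∈ v.adicCompletionIntegers ℚ →
          W''.a₆ ∈ v.adicCompletionIntegers ℚ →
          Valued.v (W''.a₁ - W'.a₁) < WithZero.exp (-(n : ℤ)) →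
          Valued.v (W''.a₂ - W'.a₂) < WithZero.exp (-(n : ℤ)) →
          Valued.v (W''.a₃ - W'.a₃) < WithZero.exp (-(n : ℤ)) →
          Valued.v (W''.a₄ - W'.a₄) < WithZero.exp (-(n : ℤ)) →
          Valued.v (W''.a₆ - W'.a₆) < WithZero.exp (-(n : ℤ)) → w W'' = w W')
    (hΔ : ∀ t ∈ v.adicCompletionIntegers ℚ, (polyCurve P₁ P₂ P₃ P₄ P₆ t).Δ ≠ 0) :
    ∃ N : ℕ, ∀ t ∈ v.adicCompletionIntegers ℚ, ∀ t' ∈ v.adicCompletionIntegers ℚ,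
      Valued.v (t - t') < WithZero.exp (-(N : ℤ)) →
        w (polyCurve P₁ P₂ P₃ P₄ P₆ t) = w (polyCurve P₁ P₂ P₃ P₄ P₆ t') := by
  -- the fibres over `O` are elliptic with integral coefficients
  have hell : ∀ t ∈ v.adicCompletionIntegers ℚ, (polyCurve P₁ P₂ P₃ P₄ P₆ t).IsElliptic :=
    fun t ht => (WeierstrassCurve.isElliptic_iff _).2 (isUnit_iff_ne_zero.2 (hΔ t ht))
  have ha : ∀ t ∈ v.adicCompletionIntegers ℚ,
      (polyCurve P₁ P₂ P₃ P₄ P₆ t).a₁ ∈ v.adicCompletionIntegers ℚ ∧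
      (polyCurve P₁ P₂ P₃ P₄ P₆ t).a₂ ∈ v.adicCompletionIntegers ℚ ∧
      (polyCurve P₁ P₂ P₃ P₄ P₆ t).a₃ ∈ v.adicCompletionIntegers ℚ ∧
      (polyCurve P₁ P₂ P₃ P₄ P₆ t).a₄ ∈ v.adicCompletionIntegers ℚ ∧
      (polyCurve P₁ P₂ P₃ P₄ P₆ t).a₆ ∈ v.adicCompletionIntegers ℚ := fun t ht =>
    ⟨eval_map_int_mem_adicCompletionIntegers v P₁ ht, eval_map_int_mem_adicCompletionIntegers v P₂ ht,
      eval_map_int_mem_adicCompletionIntegers v P₃ ht,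
      eval_map_int_mem_adicCompletionIntegers v P₄ ht,
      eval_map_int_mem_adicCompletionIntegers v P₆ ht⟩
  -- pointwise moduli of local constancy on `O`
  have key : ∀ s : v.adicCompletionIntegers ℚ, ∃ n : ℕ, ∀ t ∈ v.adicCompletionIntegers ℚ,
      Valued.v (t - s) < WithZero.exp (-(n : ℤ)) →
      w (polyCurve P₁ P₂ P₃ P₄ P₆ t) = w (polyCurve P₁ P₂ P₃ P₄ P₆ (s : v.adicCompletion ℚ)) := by
    intro s
    obtain ⟨n, hn⟩ := hloc (polyCurve P₁ P₂ P₃ P₄ P₆ (s : v.adicCompletion ℚ)) (hell s s.2)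
      (ha s s.2).1 (ha s s.2).2.1 (ha s s.2).2.2.1 (ha s s.2).2.2.2.1 (ha s s.2).2.2.2.2
    refine ⟨n, fun t ht hts => hn (polyCurve P₁ P₂ P₃ P₄ P₆ t) (hell t ht) (ha t ht).1
      (ha t ht).2.1 (ha t ht).2.2.1 (ha t ht).2.2.2.1 (ha t ht).2.2.2.2 ?_ ?_ ?_ ?_ ?_⟩
    all_goals exact lt_of_le_of_lt (valued_eval_sub_eval_le v _ ht s.2) hts
  choose n hn using key
  -- a small element, and the cover of the compact `O` by the balls of local constancy
  obtain ⟨z, hz0, hz1⟩ := adicCompletion_exists_valued_le_exp_neg_one v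
  have hzpow : ∀ m : ℕ, Valued.v (z ^ m) ≤ WithZero.exp (-(m : ℤ)) := fun m => by
    rw [Valuation.map_pow, show (-(m : ℤ)) = m • (-1 : ℤ) by simp, WithZero.exp_nsmul]
    exact pow_le_pow_left' hz1 m
  haveI : CompactSpace (v.adicCompletionIntegers ℚ) :=
    isCompact_iff_compactSpace.1 (isCompact_adicCompletionIntegers_int v)
  let B : v.adicCompletionIntegers ℚ → Set (v.adicCompletionIntegers ℚ) := fun s =>
    {t | Valued.v ((t : v.adicCompletion ℚ) - s) < Valued.v (z ^ n s)}
  have hBo : ∀ s, IsOpen (B s) := fun s =>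
    (adicCompletion_isOpen_setOf_valued_lt v (z ^ n s)).preimage
      (continuous_subtype_val.sub continuous_const)
  have hBc : (Set.univ : Set (v.adicCompletionIntegers ℚ)) ⊆ ⋃ s, B s := fun s _ =>
    Set.mem_iUnion.2 ⟨s, show Valued.v ((s : v.adicCompletion ℚ) - s) < Valued.v (z ^ n s) by
      rw [sub_self, Valuation.map_zero]
      exact (Valuation.pos_iff _).2 (pow_ne_zero _ hz0)⟩
  obtain ⟨S, hS⟩ := isCompact_univ.elim_finite_subcover B hBo hBc
  refine ⟨S.sup n, fun t ht t' ht' hlt => ?_⟩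
  obtain ⟨s, hsS, hts⟩ :=
    Set.mem_iUnion₂.1 (hS (Set.mem_univ (⟨t, ht⟩ : v.adicCompletionIntegers ℚ)))
  have hts' : Valued.v (t - (s : v.adicCompletion ℚ)) < Valued.v (z ^ n s) := hts
  have h1 : Valued.v (t - (s : v.adicCompletion ℚ)) < WithZero.exp (-(n s : ℤ)) :=
    lt_of_lt_of_le hts' (hzpow _)
  have h2 : Valued.v (t' - (s : v.adicCompletion ℚ)) < WithZero.exp (-(n s : ℤ)) := by
    have e : t' - (s : v.adicCompletion ℚ) = (t' - t) + (t - s) := by ring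
    rw [e]
    refine lt_of_le_of_lt (Valuation.map_add _ _ _) (max_lt ?_ h1)
    rw [← neg_sub, Valuation.map_neg]
    refine lt_of_lt_of_le hlt (WithZero.exp_le_exp.2 ?_)
    have := Finset.le_sup (f := n) hsS
    omega
  exact (hn s t ht h1).trans (hn s t' ht' h2).symm

/-- **Periodicity of `t ↦ w_v(E_t)` on `ℤ` modulo a power of `v`.** Under the hypotheses of
`exists_forall_valued_sub_lt_imp_eq_of_locallyConstant` (a table `w` at `v` that is locally
constant in the sense of clause (5) of `Helfgott2004_exists_local_tables_locallyConstant`, and a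
polynomial family `E_t` whose fibres over `𝒪_v` are non-singular — see
`polyCurve_Δ_ne_zero_of_forall_not_mem_pow` for the arithmetic criterion "`v(Δ(E_t))` bounded on
`ℤ`"), there is `N` such that for all integers `t ≡ t' (mod v^N)` the local curves
`E_t ×_ℚ ℚ_v`, `E_{t'} ×_ℚ ℚ_v` have the same value of `w`: the map `t ↦ w(E_t ×_ℚ ℚ_v)` factors
through `ℤ / v^N`. This is the consequence of Helfgott's Prop. 4.2–4.3 used for `p`-adic families
(e.g. `w₂(𝓔_t)` depends only on `t mod 2^N` when `v₂(Δ(𝓔_t))` is bounded).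
[cite: Helfgott2004RootNumberFamilies, §4 (Prop. 4.2, Lemma 4.4)] -/
theorem exists_forall_sub_mem_pow_imp_eq_of_locallyConstant
    {w : WeierstrassCurve (v.adicCompletion ℚ) → ℤ}
    (hloc : ∀ W' : WeierstrassCurve (v.adicCompletion ℚ), W'.IsElliptic →
        W'.a₁ ∈ v.adicCompletionIntegers ℚ → W'.a₂ ∈ v.adicCompletionIntegers ℚ →
        W'.a₃ ∈ v.adicCompletionIntegers ℚ → W'.a₄ ∈ v.adicCompletionIntegers ℚ →
        W'.a₆ ∈ v.adicCompletionIntegers ℚ →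
        ∃ n : ℕ, ∀ W'' : WeierstrassCurve (v.adicCompletion ℚ), W''.IsElliptic →
          W''.a₁ ∈ v.adicCompletionIntegers ℚ → W''.a₂ ∈ v.adicCompletionIntegers ℚ →
          W''.a₃ ∈ v.adicCompletionIntegers ℚ → W''.a₄ ∈ v.adicCompletionIntegers ℚ →
          W''.a₆ ∈ v.adicCompletionIntegers ℚ →
          Valued.v (W''.a₁ - W'.a₁) < WithZero.exp (-(n : ℤ)) →
          Valued.v (W''.a₂ - W'.a₂) < WithZero.exp (-(n : ℤ)) →
          Valued.v (W''.a₃ - W'.a₃) < WithZero.exp (-(n : ℤ)) →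
          Valued.v (W''.a₄ - W'.a₄) < WithZero.exp (-(n : ℤ)) →
          Valued.v (W''.a₆ - W'.a₆) < WithZero.exp (-(n : ℤ)) → w W'' = w W')
    (hΔ : ∀ t ∈ v.adicCompletionIntegers ℚ, (polyCurve P₁ P₂ P₃ P₄ P₆ t).Δ ≠ 0) :
    ∃ N : ℕ, ∀ t t' : ℤ, t - t' ∈ v.asIdeal ^ N →
      w ((polyCurve P₁ P₂ P₃ P₄ P₆ (t : ℚ)).baseChange (v.adicCompletion ℚ)) =
        w ((polyCurve P₁ P₂ P₃ P₄ P₆ (t' : ℚ)).baseChange (v.adicCompletion ℚ)) := by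
  obtain ⟨N, hN⟩ :=
    exists_forall_valued_sub_lt_imp_eq_of_locallyConstant P₁ P₂ P₃ P₄ P₆ v hloc hΔ
  refine ⟨N + 1, fun t t' h => ?_⟩
  rw [baseChange_polyCurve, baseChange_polyCurve, map_intCast, map_intCast]
  refine hN _ (intCast_mem_adicCompletionIntegers v t) _
    (intCast_mem_adicCompletionIntegers v t') ?_
  rw [← Int.cast_sub, adicCompletion_valued_intCast]
  exact lt_of_le_of_lt ((v.intValuation_le_pow_iff_mem _ _).2 h)
    (WithZero.exp_lt_exp.2 (by omega))

/-- **The arithmetic criterion for non-singular fibres over `𝒪_v`.** If the `v`-adic valuation of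
`Δ(E_t)` is bounded as `t` ranges over `ℤ` (`Δ(E_t) ∉ v^B` for all integers `t`), then every fibre
`E_t`, `t ∈ 𝒪_v`, is non-singular: `ℤ` is dense in `𝒪_v` (`exists_int_valued_sub_lt`) and
`v(Δ(E_r) − Δ(E_{t₀})) ≤ v(r − t₀)` (`valued_eval_sub_eval_le` for the discriminant polynomial), so a
singular fibre at `t₀ ∈ 𝒪_v` would produce integers `r` with `Δ(E_r) ∈ v^B`. [folklore] -/
theorem polyCurve_Δ_ne_zero_of_forall_not_mem_pow
    (hB : ∃ B : ℕ, ∀ t : ℤ, (polyCurve P₁ P₂ P₃ P₄ P₆ t).Δ ∉ v.asIdeal ^ B) :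
    ∀ t ∈ v.adicCompletionIntegers ℚ, (polyCurve P₁ P₂ P₃ P₄ P₆ t).Δ ≠ 0 := by
  obtain ⟨B, hB⟩ := hB
  intro t₀ ht₀ h0
  obtain ⟨z, hz0, hz1⟩ := adicCompletion_exists_valued_le_exp_neg_one v
  obtain ⟨r, hr⟩ := exists_int_valued_sub_lt v ht₀ (pow_ne_zero B hz0)
  have hzpow : Valued.v (z ^ B) ≤ WithZero.exp (-(B : ℤ)) := by
    rw [Valuation.map_pow, show (-(B : ℤ)) = B • (-1 : ℤ) by simp, WithZero.exp_nsmul]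
    exact pow_le_pow_left' hz1 B
  set D : ℤ[X] := (polyCurve P₁ P₂ P₃ P₄ P₆ (X : ℤ[X])).Δ with hD
  -- `v(Δ(E_r)) = v(Δ(E_r) - Δ(E_{t₀})) ≤ v(r - t₀) < v(z^B) ≤ exp(-B)`
  have hlip := valued_eval_sub_eval_le v D (intCast_mem_adicCompletionIntegers v r) ht₀
  have e2 : (D.map (Int.castRingHom (v.adicCompletion ℚ))).eval t₀ = 0 := by
    rw [hD, ← polyCurve_Δ]; exact h0
  rw [e2, sub_zero] at hlip
  have hlt : Valued.v ((D.map (Int.castRingHom (v.adicCompletion ℚ))).eval (r : v.adicCompletion ℚ)) ≤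
      WithZero.exp (-(B : ℤ)) :=
    hlip.trans (hr.le.trans hzpow)
  -- but `Δ(E_r)` is the integer `Δ(E_r) ∉ v^B`
  have e3 : (polyCurve P₁ P₂ P₃ P₄ P₆ (r : v.adicCompletion ℚ)).Δ =
      (((polyCurve P₁ P₂ P₃ P₄ P₆ r).Δ : ℤ) : v.adicCompletion ℚ) := by
    have h := congrArg WeierstrassCurve.Δ
      (map_polyCurve P₁ P₂ P₃ P₄ P₆ (Int.castRingHom (v.adicCompletion ℚ)) r)
    rw [WeierstrassCurve.map_Δ, eq_intCast] at h
    exact h.symm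
  rw [hD, ← polyCurve_Δ, e3, adicCompletion_valued_intCast, intValuation_le_pow_iff_mem] at hlt
  exact hB r hlt

end Families

end Literature.NumberTheory.EllipticCurves

end
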